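import Summits.CriticalPhenomena.SAWScalingLimit.Theorems.SAWLoopFugacityFlowAvoidanceLimitExcursionRatioGreen
import Literature.Probability.LatticeModels.RandomWalkLoopDeterminant

/-!
# `greenEntry` is the tree's walk-sum Green's function `rwGreen`; `greenRatio` as a ratio of walk sums
— helper file 4 of stub `stub_excursionRatio` of line `symplectic-fermion-anchor`
(crux `SAWLoopFugacityFlow.AvoidanceLimit`, stmt-CriticalPhenomena-10649)

The bridge between the anchor's matrix-inverse Green's function
`greenEntry H Λ a b = ((1 − ¼A_{H|Λ})⁻¹)_{ab}` (`…AnchorDefs`) and the tree's probabilistic one,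
`rwGreen H a b = Σ_{walks a → b of H} 4^{-|w|} ∈ ℝ≥0∞` (`RandomWalkLoopMeasure`, the normalisation
of the LERW law `LERW.law` and of the loop-measure identities of `RandomWalkLoopDeterminant`):

* `transition_eq_rwKernelMatrix` — `¼·adjMat H Λ` IS the tree's killed kernel `rwKernelMatrix H Λ`;
* `greenEntry_eq_toReal_rwGreen` — for `H ≤ ℤ²` with all edges inside `Λ` and `a, b ∈ Λ`,
  `greenEntry H Λ a b = (rwGreen H a b).toReal` (the tree's `rwGreen_eq_ofReal_inv_apply`,
  Lawler 2018 §2 "`G = (I − Q)⁻¹`");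
* `adj_mem_meshDomainFinset` — every edge of `Ω_δ` (hence of the confined graph) has its ends in
  the volume `meshDomainFinset Ω δ` (bounded `Ω`, `δ > 0`);
* the registered closing theorem `greenRatio_eq_rwGreen_div`: for bounded `Ω`, `δ > 0` and legs
  `a, b ∈ meshDomain Ω δ`,
  `greenRatio Ω S δ a b = (rwGreen (confinedGraph Ω S δ) a b).toReal / (rwGreen (Ω_δ) a b).toReal`
  — the anchor ratio is the ratio of the walk sums "walks confined to `closure S`" / "all walks of
  `Ω_δ`", i.e. the probability that the loop-erased-walk-normalising random walk excursion from `a`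
  to `b` stays confined (the form in which the sibling item `SAWChargeContinuation.AnchorExcursion`
  is typed).

Sources: G. F. Lawler, *Topics in loop measures and the loop-erased walk*, Probab. Surveys 15
(2018), §2 [Lawler2018]; folklore. No definitions.
-/

noncomputable section

open scoped BigOperators Topology symmDiff ENNReal
open Filter Finset
open Literature.Probability.RandomPlanarGeometry Literature.Probability.LatticeModels

namespace Summit.CriticalPhenomena.SAWScalingLimit.Theorems.AvoidanceLimit.Anchor

/-- `¼·A_{H|Λ}` is the tree's killed simple-random-walk kernel `Q_Λ` of `H`. [folklore] -/
theorem transition_eq_rwKernelMatrix (H : SimpleGraph (Site 2)) (Λ : Finset (Site 2)) :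
    (4 : ℝ)⁻¹ • adjMat H Λ = rwKernelMatrix H Λ := by
  ext x y
  rw [KilledGreen.transition_apply, rwKernelMatrix_apply, one_div]

/-- **`greenEntry = rwGreen`**: for `H ≤ ℤ²` all of whose edges lie inside `Λ` and `a, b ∈ Λ`, the
matrix-inverse Green's function of the anchor is the walk sum `Σ_{walks a → b of H} 4^{-|w|}` of the
tree (finite). [cite: Lawler2018, §2 (p. 6, G = (I − Q)⁻¹)] -/
theorem greenEntry_eq_toReal_rwGreen {H : SimpleGraph (Site 2)} (hH : H ≤ zdGraph 2)
    {Λ : Finset (Site 2)} (hΛ : ∀ x y : Site 2, H.Adj x y → x ∈ Λ) {a b : Site 2}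
    (ha : a ∈ Λ) (hb : b ∈ Λ) : greenEntry H Λ a b = (rwGreen H a b).toReal := by
  have h := rwGreen_eq_ofReal_inv_apply hH hΛ ⟨a, ha⟩ ⟨b, hb⟩
  have hG : greenEntry H Λ a b = ((1 : Matrix Λ Λ ℝ) - rwKernelMatrix H Λ)⁻¹ ⟨a, ha⟩ ⟨b, hb⟩ := by
    rw [greenEntry, dif_pos ⟨ha, hb⟩, transition_eq_rwKernelMatrix]
  have hnn : 0 ≤ ((1 : Matrix Λ Λ ℝ) - rwKernelMatrix H Λ)⁻¹ ⟨a, ha⟩ ⟨b, hb⟩ := by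
    rw [← hG]
    exact greenEntry_nonneg hH Λ a b
  change rwGreen H a b = _ at h
  rw [h, ENNReal.toReal_ofReal hnn, hG]

/-- `rwGreen` of a finite piece of `ℤ²` between vertices of the volume is finite. [folklore] -/
theorem rwGreen_ne_top_of_mem {H : SimpleGraph (Site 2)} (hH : H ≤ zdGraph 2)
    {Λ : Finset (Site 2)} (hΛ : ∀ x y : Site 2, H.Adj x y → x ∈ Λ) {a b : Site 2}
    (ha : a ∈ Λ) (hb : b ∈ Λ) : rwGreen H a b ≠ ∞ :=
  rwGreen_ne_top hH hΛ ⟨a, ha⟩ ⟨b, hb⟩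

/-- Every edge of `Ω_δ` has its tail in the volume `meshDomainFinset Ω δ` (bounded `Ω`, `δ > 0`).
[folklore] -/
theorem adj_mem_meshDomainFinset {Ω : Set ℂ} {δ : ℝ} (hΩ : Bornology.IsBounded Ω) (hδ : 0 < δ)
    {x y : Site 2} (h : (discreteDomainGraph Ω δ).Adj x y) : x ∈ meshDomainFinset Ω δ := by
  rw [← Finset.mem_coe, coe_meshDomainFinset hΩ hδ]
  exact (discreteDomainGraph_adj_iff.1 h).2.1

/-- Every edge of the confined graph has its tail in the volume `meshDomainFinset Ω δ`. [folklore] -/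
theorem confined_adj_mem_meshDomainFinset {Ω S : Set ℂ} {δ : ℝ} (hΩ : Bornology.IsBounded Ω)
    (hδ : 0 < δ) {x y : Site 2} (h : (confinedGraph Ω S δ).Adj x y) : x ∈ meshDomainFinset Ω δ :=
  adj_mem_meshDomainFinset hΩ hδ (confinedGraph_le Ω S δ h)

/-- The denominator of the anchor ratio as a walk sum: for bounded `Ω`, `δ > 0`, `a, b ∈ Ω_δ`,
`greenEntry (Ω_δ) (meshDomainFinset Ω δ) a b = (rwGreen (Ω_δ) a b).toReal`. [folklore] -/
theorem greenEntry_domain_eq_toReal_rwGreen {Ω : Set ℂ} {δ : ℝ} (hΩ : Bornology.IsBounded Ω)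
    (hδ : 0 < δ) {a b : Site 2} (ha : a ∈ meshDomain Ω δ) (hb : b ∈ meshDomain Ω δ) :
    greenEntry (discreteDomainGraph Ω δ) (meshDomainFinset Ω δ) a b =
      (rwGreen (discreteDomainGraph Ω δ) a b).toReal := by
  have ha' : a ∈ meshDomainFinset Ω δ := by rwa [← Finset.mem_coe, coe_meshDomainFinset hΩ hδ]
  have hb' : b ∈ meshDomainFinset Ω δ := by rwa [← Finset.mem_coe, coe_meshDomainFinset hΩ hδ]
  exact greenEntry_eq_toReal_rwGreen
    ((discreteDomainGraph_le_meshGraph Ω δ).trans (meshGraph_le_zdGraph Ω δ))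
    (fun x y h => adj_mem_meshDomainFinset hΩ hδ h) ha' hb'

/-- The numerator of the anchor ratio as a walk sum over CONFINED walks. [folklore] -/
theorem greenEntry_confined_eq_toReal_rwGreen {Ω S : Set ℂ} {δ : ℝ} (hΩ : Bornology.IsBounded Ω)
    (hδ : 0 < δ) {a b : Site 2} (ha : a ∈ meshDomain Ω δ) (hb : b ∈ meshDomain Ω δ) :
    greenEntry (confinedGraph Ω S δ) (meshDomainFinset Ω δ) a b =
      (rwGreen (confinedGraph Ω S δ) a b).toReal := by
  have ha' : a ∈ meshDomainFinset Ω δ := by rwa [← Finset.mem_coe, coe_meshDomainFinset hΩ hδ]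
  have hb' : b ∈ meshDomainFinset Ω δ := by rwa [← Finset.mem_coe, coe_meshDomainFinset hΩ hδ]
  exact greenEntry_eq_toReal_rwGreen (confinedGraph_le_zdGraph Ω S δ)
    (fun x y h => confined_adj_mem_meshDomainFinset hΩ hδ h) ha' hb'

/-- **Registered closing theorem of this helper file — the anchor ratio as a ratio of walk sums.**
For bounded `Ω`, `δ > 0` and legs `a, b ∈ Ω_δ`:
`greenRatio Ω S δ a b = (Σ_{walks a → b of Ω_δ inside closure S} 4^{-|w|}) / (Σ_{walks a → b of Ω_δ} 4^{-|w|})`,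
both walk sums being the tree's `rwGreen` (finite here). [folklore] -/
theorem greenRatio_eq_rwGreen_div :
    ∀ (Ω S : Set ℂ) (δ : ℝ) (a b : Site 2), Bornology.IsBounded Ω → 0 < δ →
      a ∈ meshDomain Ω δ → b ∈ meshDomain Ω δ →
      greenRatio Ω S δ a b =
        (rwGreen (confinedGraph Ω S δ) a b).toReal / (rwGreen (discreteDomainGraph Ω δ) a b).toReal := by
  intro Ω S δ a b hΩ hδ ha hb
  rw [greenRatio, greenEntry_confined_eq_toReal_rwGreen hΩ hδ ha hb,
    greenEntry_domain_eq_toReal_rwGreen hΩ hδ ha hb]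

end Summit.CriticalPhenomena.SAWScalingLimit.Theorems.AvoidanceLimit.Anchor

end
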